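import Mathlib.CategoryTheory.SingleObj
import Mathlib.RingTheory.RootsOfUnity.Complex
import Mathlib.Analysis.Complex.Polynomial.Basic
import Literature.AnabelianGeometry.EtaleTheta.Discharge.Sec4NonVacuityCovering
import Literature.AnabelianGeometry.EtaleTheta.Discharge.Sec4NonVacuityProp42iv
import HarnessLib

/-!
# [EtTh] §4 with a COVERING, integral exponents: the Kummer-tower toy where `N`-th roots exist ONLY upstairs
# (consistency witness, part 7 — data)

S. Mochizuki, *The étale theta function and its Frobenioid-theoretic manifestations*, Publ. RIMS **45**
(2009) [MochizukiEtTh2009], §4: Def 4.1 (PDF p.86), Prop 4.2 (iii) p.88 and its proof p.89 — ERRATUM E2: "over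
some tempered covering of `X^log` … `f` admits an `N`-th root" (sub-node L01a of `plan/L2/SUBDAG-EtTh-Prop42.md`).

CONSISTENCY WITNESS, TOY — the variant `ToyCovZ` of `ToyCov` (`Sec4NonVacuityCovering.lean`, p427822) with
INTEGRAL exponents: same base `D = SingleObj ℕ+` (Kummer covers `t ↦ t^N`), same `Φ = ℚ_{≥0}`, but
`B₀ = B₀^Λ := ℂˣ × t^ℤ` ("constant × monomial `c·t^n`, `n ∈ ℤ`"), pull-back `(c, n) ↦ (c, N n)`, divisor
`(c, n) ↦ n·𝔭` (`Toy.divHomQ`).  Here — unlike `ToyCov`, whose exponents are divisible — the uniformiser `t` has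
NO square root in `O^×(A_⊙^birat)` (sequel: `ToyCovZ.not_exists_sq_eq_uniformiser`), yet along the pull-back
morphism over the degree-`N` cover it becomes `t^N = (t)^N` upstairs, so the covering input L01a HOLDS and the
typed Prop 4.2 (iii) FIRES (sequel): the kernel picture of ERRATUM E2 "roots exist only after passing to a
covering".  PRICE (honest): with integral exponents the pull-back of `B` along a cover is injective but NOT
surjective, so `B` is not a monoid on the (collapsed, all-morphisms-FSM) base in the sense of [FrdI] Def 1.1 (ii)
and "`C` is a Frobenioid" is NOT available here (it is at `ToyCov`, p428819) — Thm 4.4 (i)/(iii) are not claimed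
for `ToyCovZ`.  This file: toy DATA (`def`s are objects; no `Prop` definition, no named fact, no instance) and the
REAL clauses perfect / monoid type `ℤ` / `A_⊙` Frobenius-trivial / `O^×(A) = ℂˣ` / every object `μ_N`-saturated.
Trivial [FrdI] vocabularies; not a curve; consistency ≠ faithfulness; typed ≠ proved.  Nothing here bears on,
or takes a side on, [IUTchIII] Cor. 3.12.
-/

noncomputable section

namespace Literature.AnabelianGeometry.EtaleTheta

open CategoryTheory Opposite Literature.AlgebraicGeometry.Frobenioids
open scoped NNRat

namespace ToyCovZ

open ToyCov (Base pt deg cover deg_cover hom_eq aut_eq_one epi catVocab powFunctor powFunctor_map_apply)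

/-! ## Plumbing -/

/-- On groupifications the `N`-th power map induces the `N`-th power map. [folklore] -/
private theorem gpMap_powMonoidHom (M : Type) [CommMonoid M] (N : ℕ) :
    gpMap (powMonoidHom N : M →* M) = powMonoidHom N := by
  apply Algebra.GrothendieckGroup.lift.symm.injective
  rw [Algebra.GrothendieckGroup.lift_symm_apply, Algebra.GrothendieckGroup.lift_symm_apply]
  ext m
  change gpMap (powMonoidHom N) (Algebra.GrothendieckGroup.of m) = Algebra.GrothendieckGroup.of m ^ N
  rw [gpMap_of, powMonoidHom_apply, map_pow]

/-- A base morphism with a right inverse is the identity (`ℕ_{≥1}` has trivial units). [folklore] -/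
private theorem eq_id_of_comp_eq_id {A B : Base} {f : A ⟶ B} {g : B ⟶ A} (h : f ≫ g = 𝟙 A) : deg f = 1 := by
  have h' : (deg g : ℕ) * (deg f : ℕ) = 1 := by exact_mod_cast congrArg (fun x : ℕ+ => (x : ℕ)) (h : deg g * deg f = 1)
  exact PNat.coe_eq_one_iff.mp (Nat.eq_one_of_mul_eq_one_left h')

/-! ## The data `Φ₀ = ℚ_{≥0}`, `B₀ = ℂˣ × t^ℤ` -/

/-- `B₀(∗) = B₀^Λ(∗)`: constants times monomials with INTEGRAL exponents, `ℂˣ × ℤ`. [cite: MochizukiEtTh2009, Def 3.3 p.73] -/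
abbrev Fn : Type := ℂˣ × Multiplicative ℤ

/-- `B₀` as a functor: pull-back along a morphism of degree `N` is `(c, n) ↦ (c, N n)` (constants stay
constant, `t ↦ t^N`). [cite: MochizukiEtTh2009, Def 3.3 p.73] -/
def fnFunctor : Baseᵒᵖ ⥤ CommMonCat.{0} where
  obj _ := CommMonCat.of Fn
  map f := CommMonCat.ofHom (MonoidHom.prodMap (MonoidHom.id ℂˣ) (powMonoidHom ((deg f.unop : ℕ+) : ℕ)))
  map_id A := by
    apply CommMonCat.hom_ext
    ext x
    · rfl
    · change x.2 ^ ((1 : ℕ+) : ℕ) = x.2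
      rw [PNat.one_coe, pow_one]
  map_comp f g := by
    apply CommMonCat.hom_ext
    ext x
    · rfl
    · change x.2 ^ ((deg f.unop * deg g.unop : ℕ+) : ℕ) = (x.2 ^ (deg f.unop : ℕ)) ^ (deg g.unop : ℕ)
      rw [PNat.mul_coe, pow_mul]

/-- Pull-back in `B₀` along `f`. [cite: MochizukiEtTh2009, Def 3.3 p.73] -/
@[simp] theorem fnFunctor_map_apply {A B : Baseᵒᵖ} (f : A ⟶ B) (x : Fn) :
    (fnFunctor.map f).hom x = (x.1, x.2 ^ ((deg f.unop : ℕ+) : ℕ)) := rfl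

/-- **Def 3.3 (iii) data of the integral Kummer-tower toy**: `Φ₀ = ℚ_{≥0}`, `B₀ = ℂˣ × t^ℤ`, divisor map
`(c, n) ↦ n·𝔭`, `F₀ = B₀`, everything non-cuspidal. [cite: MochizukiEtTh2009, Def 3.3 p.73] -/
def divisorMonoids : DivisorMonoids.{0, 0, 0} Base where
  Φ₀ := powFunctor (Multiplicative ℚ≥0)
  B₀ := fnFunctor
  isUnit_B₀ _ b := by
    change IsUnit (M := Fn) b
    exact Group.isUnit _
  div₀ _ := Toy.divHomQ.comp (MonoidHom.snd _ _)
  div₀_natural f b := by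
    change Toy.divHomQ (b.2 ^ ((deg f.unop : ℕ+) : ℕ)) =
      gpMap (powMonoidHom ((deg f.unop : ℕ+) : ℕ) : Multiplicative ℚ≥0 →* Multiplicative ℚ≥0) (Toy.divHomQ b.2)
    rw [gpMap_powMonoidHom, map_pow]
    rfl
  F₀ _ := ⊤
  F₀_map _ _ _ := trivial
  ncsp₀ _ := ⊤
  csp₀ _ := ⊥
  ncsp₀_map _ _ _ := trivial
  csp₀_map f x hx := by
    rw [Submonoid.mem_bot] at hx ⊢
    rw [hx, map_one]
  existsUnique_ncsp_csp _ x := by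
    refine ⟨(⟨x, trivial⟩, ⟨1, Submonoid.mem_bot.mpr rfl⟩), mul_one x, ?_⟩
    rintro ⟨a, c⟩ h
    have hc : c.1 = 1 := Submonoid.mem_bot.mp c.2
    have ha : a.1 = x := by
      have h' : a.1 * c.1 = x := h
      rwa [hc, mul_one] at h'
    exact Prod.ext (Subtype.ext ha) (Subtype.ext hc)

/-- **Def 3.6 (i) data of the integral Kummer-tower toy** (`Λ = ℤ`, `Φ₀^ℝ = Φ₀`, `B₀^Λ = B₀ = ℂˣ × t^ℤ`,
`F₀^Λ = B₀`, `ℝ·Φ₀^cnst =` everything), over the trivial monoid vocabulary. [cite: MochizukiEtTh2009, Def 3.6 p.76] -/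
def realified : RealifiedDivisorMonoids (D₀ := Base) Toy.monoidVocab where
  toDivisorMonoids := divisorMonoids
  Λ := MonoidType.Z
  ΦR := powFunctor (Multiplicative ℚ≥0)
  toR _ := MonoidHom.id _
  toR_natural _ _ := rfl
  isRealification _ := trivial
  BΛ := fnFunctor
  isUnit_BΛ _ b := by
    change IsUnit (M := Fn) b
    exact Group.isUnit _
  divΛ _ := Toy.divHomQ.comp (MonoidHom.snd _ _)
  divΛ_natural f b := by
    change Toy.divHomQ (b.2 ^ ((deg f.unop : ℕ+) : ℕ)) =
      gpMap (powMonoidHom ((deg f.unop : ℕ+) : ℕ) : Multiplicative ℚ≥0 →* Multiplicative ℚ≥0) (Toy.divHomQ b.2)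
    rw [gpMap_powMonoidHom, map_pow]
    rfl
  FΛ _ := ⊤
  FΛ_map _ _ _ := trivial
  cnstR _ := ⊤
  cnstR_map _ _ _ := trivial
  divΛ_mem_cnstR _ _ _ := trivial
  cnstR_root _ _ _ _ := trivial
  cnst_le_cnstR _ _ _ := trivial
  ncspR _ := ⊤
  cspR _ := ⊥
  toR_ncsp _ _ _ := trivial
  toR_csp _ _ hx := hx

/-- **Def 3.6 (ii), the integral Kummer-tower toy tempered Frobenioid**: `D → D₀` the identity,
`Φ = Φ^{ℝ-log} = ℚ_{≥0}` (group-saturated, perfect), `Φ^{bs-fld} = ℚ_{≥0}` monoprime (REAL), and `t = (1, t¹) ∈ F`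
has divisor `𝔭 ≠ 0` (condition (b), REAL). [cite: MochizukiEtTh2009, Def 3.6 p.77] -/
def temperedFrobenioid : TemperedFrobenioid realified Base catVocab where
  isConnected := zigzag_isConnected fun j₁ j₂ => by rw [Subsingleton.elim j₁ j₂]
  isTotallyEpimorphic := ⟨fun f => epi _ _ f⟩
  base := 𝟭 _
  Φ := ⟨fun _ => ⊤, fun _ _ _ => trivial⟩
  isGroupSaturated A := (isGroupSaturated_iff' _).2 fun _ _ _ _ _ _ => trivial
  isPerfFactorial _ := trivial
  isDivisorialOn := trivial
  isMonoprime_bsFld A := Toy.isMonoprime_of_eq_top_nnrat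
    (eq_top_iff.2 fun x _ => Submonoid.mem_inf.2 ⟨Submonoid.mem_top x,
      (Subgroup.mem_top (Algebra.GrothendieckGroup.of x) :
        Algebra.GrothendieckGroup.of x ∈
          (⊤ : Subgroup (Algebra.GrothendieckGroup (Multiplicative ℚ≥0))))⟩)
  exists_FΛ_div_ne A := ⟨((1 : ℂˣ), Multiplicative.ofAdd (1 : ℤ)), trivial,
    (Multiplicative.ofAdd (1 : ℚ≥0) : Multiplicative ℚ≥0), trivial, (1 : Multiplicative ℚ≥0), trivial,
    fun h => one_ne_zero (Multiplicative.ofAdd.injective h), by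
      change Toy.divHomQ (Multiplicative.ofAdd 1) =
        Algebra.GrothendieckGroup.of (M := Multiplicative ℚ≥0) (Multiplicative.ofAdd 1) /
          Algebra.GrothendieckGroup.of (M := Multiplicative ℚ≥0) 1
      rw [Toy.divHomQ_ofAdd_one, (Algebra.GrothendieckGroup.of (M := Multiplicative ℚ≥0)).map_one, div_one]⟩

/-- "whose monoid type is `ℤ`". [cite: MochizukiEtTh2009, Def 4.1 p.86] -/
theorem temperedFrobenioid_monoidType : temperedFrobenioid.monoidType = MonoidType.Z := rfl

/-- "whose divisor monoid `Φ` is perfect": `Φ(A) = ℚ_{≥0}`. [cite: MochizukiEtTh2009, Def 4.1 p.86] -/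
theorem temperedFrobenioid_isPerfect (A : Baseᵒᵖ) : IsPerfect (temperedFrobenioid.Φ.carrier A) :=
  isPerfect_of_mulEquiv_nnrat (N := ↥(⊤ : Submonoid (Multiplicative ℚ≥0))) Submonoid.topEquiv

/-- `B` is objectwise group-like. [cite: MochizukiEtTh2009, Def 3.6 p.77] -/
theorem ratFnFunctor_isGroupLike :
    Objectwise (fun M _ => IsGroupLike M) temperedFrobenioid.ratFnFunctor :=
  temperedFrobenioid.ratFnFunctor_isGroupLike realified.isUnit_BΛ

/-- `Φ = ℚ_{≥0}` is objectwise divisorial (monoprime). [cite: MochizukiEtTh2009, Def 3.6 p.77] -/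
theorem divisorMonoid_isDivisorial :
    Objectwise (fun M _ => IsDivisorial M) temperedFrobenioid.divisorMonoid :=
  fun _ => (Toy.isMonoprime_of_eq_top_nnrat (S := (⊤ : Submonoid (Multiplicative ℚ≥0))) rfl).isDivisorial

/-! ## The §4 setting over the Kummer-tower toy -/

/-- `A_⊙ := (∗, 0)`. [cite: MochizukiEtTh2009, Def 4.1 p.86] -/
def Aodot : temperedFrobenioid.category :=
  ModelFrobenioid.zeroObj _ _ _ pt

/-- `A_⊙` is Frobenius-trivial (L1's [FrdI] Thm 5.2 proof step). [cite: MochizukiEtTh2009, Def 4.1 p.86] -/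
theorem isFrobeniusTrivial_Aodot :
    PreFrobenioid.IsFrobeniusTrivial temperedFrobenioid.toElem Aodot :=
  ModelFrobenioid.isFrobeniusTrivial_zeroObj ratFnFunctor_isGroupLike _

/-- **The §4 setting WITH COVERINGS, integral exponents**: the `BiKummerSetting` over the integral Kummer-tower
toy, through abc-iut-L2-t9's `mkOfModelCanonical` (Galois objects := all, `Π^tp_X ↠ Aut_D(A^bs)` := trivial —
surjective by `ToyCov.galoisSurj_surjective` —, `(N,H)`-slot := `True`, `A_⊙ := (∗, 0)`). [cite: MochizukiEtTh2009, Def 4.1 p.86] -/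
def biKummerSetting : BiKummerSetting Toy.temperedGroup realified Base catVocab :=
  BiKummerSetting.mkOfModelCanonical Toy.temperedGroup temperedFrobenioid temperedFrobenioid_monoidType
    temperedFrobenioid_isPerfect (fun _ => True) (fun _ _ => 1) ToyCov.galoisSurj_surjective (fun _ _ _ => True)
    Aodot isFrobeniusTrivial_Aodot trivial


/-! ## Units of the integral Kummer-tower toy: `O^×(A) ≅ ℂˣ`, every object is `μ_N`-saturated -/

section Units

variable (A : temperedFrobenioid.category)

/-- Every automorphism of an object of the toy Frobenioid is a unit: its base part is an automorphism of
`∗`, hence `1`, and isomorphisms have Frobenius degree `1`. [cite: MochizukiFrdI2008, Thm. 5.2(ii) p.101] -/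
private theorem mem_units' (σ : Aut A) : σ ∈ ModelFrobenioid.units A := by
  refine ⟨?_, (ModelFrobenioid.degFr_hom_eq_one σ).1⟩
  have h : ModelFrobenioid.baseMap σ.hom ≫ ModelFrobenioid.baseMap σ.inv = 𝟙 _ := by
    rw [← ModelFrobenioid.baseMap_comp, σ.hom_inv_id, ModelFrobenioid.baseMap_id]
  exact hom_eq (eq_id_of_comp_eq_id h)

/-- The constant `c ∈ ℂˣ` as a rational function on `A^bs` (divisor `0`). [cite: MochizukiEtTh2009, Def 3.6 p.77] -/
def cnst (c : ℂˣ) : temperedFrobenioid.ratFnFunctor.obj (op A.base) :=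
  ⟨(((c, 1) : Fn), 1), by
    change Toy.divHomQ 1 = temperedFrobenioid.ΦgpToRlog _ 1
    exact (map_one _).trans (map_one _).symm⟩

/-- The constants as a homomorphism `ℂˣ → B(A^bs)^×`. [cite: MochizukiEtTh2009, Def 3.6 p.77] -/
def cnstUnitHom : ℂˣ →* (temperedFrobenioid.ratFnFunctor.obj (op A.base))ˣ where
  toFun c := ⟨cnst A c, cnst A c⁻¹,
    Subtype.ext (Prod.ext (Prod.ext (mul_inv_cancel c) (mul_one _)) (mul_one _)),
    Subtype.ext (Prod.ext (Prod.ext (inv_mul_cancel c) (mul_one _)) (mul_one _))⟩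
  map_one' := Units.ext (Subtype.ext rfl)
  map_mul' _ _ := Units.ext (Subtype.ext (Prod.ext (Prod.ext rfl (mul_one _).symm) (mul_one _).symm))

/-- `cnstUnitHom` is injective (constants embed in `B(A^bs)^×`). [cite: MochizukiFrdI2008, Thm. 5.2(ii) p.101] -/
theorem cnstUnitHom_injective : Function.Injective (cnstUnitHom A) := fun _ _ h =>
  congrArg (fun u : (temperedFrobenioid.ratFnFunctor.obj (op A.base))ˣ =>
    (u : temperedFrobenioid.ratFnFunctor.obj (op A.base)).1.1.1) h

/-- `0 = Div_B(c)` for a constant. [cite: MochizukiFrdI2008, Thm. 5.2(i) p.100] -/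
theorem of_one_eq_divB_cnst (c : ℂˣ) :
    Algebra.GrothendieckGroup.of (1 : temperedFrobenioid.divisorMonoid.obj (op A.base)) =
      divB temperedFrobenioid.divisorMonoid temperedFrobenioid.ratFnFunctor
        temperedFrobenioid.divBNatTrans (op A.base) (cnst A c) := by
  rw [map_one]
  rfl

/-- **"Multiplication by the constant `c`"**: the unit automorphism `(1, id, 0, c) ∈ O^×(A)` (L1's
`ModelFrobenioid.unitAut`). [cite: MochizukiFrdI2008, Thm. 5.2(ii) p.101] -/
def coefAut (c : ℂˣ) : Aut A :=
  ModelFrobenioid.unitAut A 1 1 (cnst A c) (cnst A c⁻¹) (of_one_eq_divB_cnst A c) (of_one_eq_divB_cnst A c⁻¹)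
    (one_mul 1) (Subtype.ext (Prod.ext (Prod.ext (inv_mul_cancel c) (mul_one _)) (mul_one _)))

/-- `coefAut c ∈ O^×(A)`. [cite: MochizukiFrdI2008, Thm. 5.2(ii) p.101] -/
theorem coefAut_mem_units (c : ℂˣ) : coefAut A c ∈ ModelFrobenioid.units A :=
  ModelFrobenioid.unitAut_mem_units _ _ _ _ _ _ _ _ _

/-- `coefAut c` as an element of `O^×(A)`. [cite: MochizukiFrdI2008, Thm. 5.2(ii) p.101] -/
def coefUnit (c : ℂˣ) : ModelFrobenioid.units A := ⟨coefAut A c, coefAut_mem_units A c⟩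

/-- Under `O^×(A) ↪ B(A^bs)^×` ([FrdI] Thm 5.2 (ii)) `coefAut c ↦ c`. [cite: MochizukiFrdI2008, Thm. 5.2(ii) p.101] -/
theorem unitsToRatFn_coefUnit (c : ℂˣ) :
    ModelFrobenioid.unitsToRatFn A (coefUnit A c) = cnstUnitHom A c :=
  Units.ext rfl

/-- **`O^×(A) = ℂˣ`**: every unit of `A` is multiplication by a constant — its rational function `u` has
`Div_B(u) = 0` (`Φ` sharp), hence monomial part `0`. [cite: MochizukiFrdI2008, Thm. 5.2(ii) p.101] -/
theorem exists_eq_cnstUnitHom (τ : ModelFrobenioid.units A) :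
    ∃ c : ℂˣ, ModelFrobenioid.unitsToRatFn A τ = cnstUnitHom A c := by
  have h2 : (ModelFrobenioid.unitsToRatFn A τ : temperedFrobenioid.ratFnFunctor.obj (op A.base)).1.2 = 1 :=
    ModelFrobenioid.divB_unitsToRatFn_eq_one (divisorMonoid_isDivisorial A.base).isSharp τ
  have h12 : (ModelFrobenioid.unitsToRatFn A τ : temperedFrobenioid.ratFnFunctor.obj (op A.base)).1.1.2 = 1 := by
    have hrel := (ModelFrobenioid.unitsToRatFn A τ : temperedFrobenioid.ratFnFunctor.obj (op A.base)).2
    change Toy.divHomQ _ = temperedFrobenioid.ΦgpToRlog _ _ at hrel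
    rw [h2, map_one] at hrel
    exact Toy.divHomQ_injective (hrel.trans (map_one Toy.divHomQ).symm)
  exact ⟨(ModelFrobenioid.unitsToRatFn A τ : temperedFrobenioid.ratFnFunctor.obj (op A.base)).1.1.1,
    Units.ext (Subtype.ext (Prod.ext (Prod.ext rfl h12) h2))⟩

/-- `O^×(A) ↪ B(A^bs)^×` is injective here (`Φ = ℚ_{≥0}` integral). [cite: MochizukiFrdI2008, Thm. 5.2(ii) p.101] -/
private theorem unitsToRatFn_injective' : Function.Injective (ModelFrobenioid.unitsToRatFn A) :=
  ModelFrobenioid.unitsToRatFn_injective (divisorMonoid_isDivisorial A.base).isPreDivisorial.isIntegral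

/-- **Units of the integral Kummer-tower toy**: every automorphism is a unit, and `O^×(A) ↪ B(A^bs)^×` is
injective. [cite: MochizukiFrdI2008, Thm. 5.2(ii) p.101] -/
theorem mem_units_and_unitsToRatFn_injective :
    (∀ σ : Aut A, σ ∈ ModelFrobenioid.units A) ∧ Function.Injective (ModelFrobenioid.unitsToRatFn A) :=
  ⟨mem_units' A, unitsToRatFn_injective' A⟩

/-- **Every object of the Kummer-tower toy is `μ_N`-saturated, for every `N`** (REAL [FrdII] Def 2.1 (i)):
`μ_N(A) ⊆ O^×(A) = ℂˣ` is the group of `N`-th roots of unity, cyclic of order `N`, generated by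
`exp(2πi/N)`. [cite: MochizukiEtTh2009, Def 4.1 p.87] -/
theorem isMuSaturated (N : ℕ+) : temperedFrobenioid.IsMuSaturated A N := by
  have hN : (N : ℕ) ≠ 0 := PNat.ne_zero N
  have hζ := Complex.isPrimitiveRoot_exp N hN
  have hζu : IsPrimitiveRoot (hζ.isUnit hN).unit N := hζ.isUnit_unit hN
  set ζu : ℂˣ := (hζ.isUnit hN).unit
  have hinj := unitsToRatFn_injective' A
  have hord : orderOf (coefUnit A ζu) = (N : ℕ) := by
    rw [← orderOf_injective _ hinj (coefUnit A ζu), unitsToRatFn_coefUnit,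
      orderOf_injective _ (cnstUnitHom_injective A) ζu]
    exact hζu.eq_orderOf.symm
  refine ⟨(coefUnit A ζu : Aut A), ⟨⟨(coefAut_mem_units A ζu).1, (coefAut_mem_units A ζu).2⟩, ?_⟩, ?_, ?_⟩
  · have h := congrArg Subtype.val (pow_orderOf_eq_one (coefUnit A ζu))
    rwa [hord, SubmonoidClass.coe_pow] at h
  · rw [show (coefUnit A ζu : Aut A) = ((coefUnit A ζu : ModelFrobenioid.units A) : Aut A) from rfl,
      Subgroup.orderOf_coe, hord]
  · rintro τ ⟨hτu, hτN⟩
    let τu : ModelFrobenioid.units A := ⟨τ, hτu.1, hτu.2⟩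
    obtain ⟨c, hc⟩ := exists_eq_cnstUnitHom A τu
    have hτuN : τu ^ (N : ℕ) = 1 := Subtype.ext (by rw [SubmonoidClass.coe_pow]; exact hτN)
    have hcN : c ^ (N : ℕ) = 1 := cnstUnitHom_injective A (by
      rw [map_pow, ← hc, ← map_pow, hτuN, map_one, map_one])
    have hcmem : c ∈ Subgroup.zpowers ζu := by
      rw [hζu.zpowers_eq]
      exact (mem_rootsOfUnity _ c).2 hcN
    obtain ⟨i, hi⟩ := Subgroup.mem_zpowers_iff.mp hcmem
    have hτu' : (coefUnit A ζu) ^ i = τu :=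
      hinj (by rw [map_zpow, unitsToRatFn_coefUnit, ← map_zpow, hi, hc])
    exact Subgroup.mem_zpowers_iff.mpr ⟨i, by
      have h := congrArg Subtype.val hτu'
      rwa [SubgroupClass.coe_zpow] at h⟩

end Units

/-- **The integral §4 setting WITH COVERINGS is inhabited, with REAL `μ_N`-saturation**.
[cite: MochizukiEtTh2009, Def 4.1 p.87] -/
theorem nonempty_biKummerSetting_muSaturated_int :
    ∃ S : BiKummerSetting Toy.temperedGroup realified Base catVocab, ∀ (A : S.C) (N : ℕ+), S.IsMuSaturated A N :=
  ⟨biKummerSetting, fun A N => isMuSaturated A N⟩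

end ToyCovZ

end Literature.AnabelianGeometry.EtaleTheta

end
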